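import Mathlib

/-!
# Landau tails are super-self-similar in every core ball (velocity)

Helper file for crux `LandauTailBlowup` (stmt-NavierStokesRegularity-1944), line `registered`,
registered stub `landauTail_core_velocity_unbounded` (C1, "the velocity is super-self-similar in
every core ball").

A *Landau tail* of a blow-up at the space–time origin means
`√(−t) • u t (√(−t) • y) → U y` as `t → 0⁻` for every `y ≠ 0`, where the profile `U` is nonzero and
`(−1)`-homogeneous (`U (c • x) = c⁻¹ • U x`, so `‖U‖ ∼ 1/‖y‖` along every ray on which it does not
vanish).  This file turns the route header's phrase "super-self-similar core / Type II at the core"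
into a theorem: for every core ratio `ρ > 0` and every level `M`, for all `t < 0` close to `0` the
parabolic core ball `B(0, ρ√(−t))` contains a point where `√(−t) ‖u t x‖ > M`.

The proof is elementary (no PDE): homogeneity forces `U 0 = 0`, so the nonzero point `x₁` of `U`
is off the origin and `‖U (c • x₁)‖ = c⁻¹ ‖U x₁‖ → ∞` as `c → 0⁺`; pick `c` with `c‖x₁‖ < ρ` and
`c⁻¹‖U x₁‖ > |M|`, put `y₀ := c • x₁`, and read the tail at `y₀`: by continuity of the norm,
eventually `‖√(−t) • u t (√(−t) • y₀)‖ > |M| ≥ M`, while `x := √(−t) • y₀` lies in the core ball.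
-/

set_option linter.dupNamespace false

namespace Summit.NavierStokesRegularity.NavierStokesRegularity.Theorems

open Filter Topology

/-- **The velocity of a Landau-tailed blow-up is super-self-similar in every core ball**
(registered stub C1 of crux `LandauTailBlowup`, stmt-NavierStokesRegularity-1944).  If
`√(−t) • u t (√(−t) • y) → U y` as `t → 0⁻` for every `y ≠ 0`, with `U` nonzero and
`(−1)`-homogeneous, then for every `ρ > 0` and every `M`, eventually as `t → 0⁻` some point `x` of
the parabolic core ball `B(0, ρ√(−t))` has `M < √(−t) ‖u t x‖`.  Proof: `U 0 = 0` by homogeneity, so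
the nonzero point `x₁` of `U` is off the origin; along its ray `‖U (c • x₁)‖ = c⁻¹‖U x₁‖`, so a small
`c > 0` gives `y₀ := c • x₁ ≠ 0` with `‖y₀‖ < ρ` and `‖U y₀‖ > |M|`; the tail at `y₀` and continuity
of the norm give eventually `‖√(−t) • u t (√(−t) • y₀)‖ > |M|`, and `x := √(−t) • y₀` works. -/
theorem landauTail_core_velocity_unbounded : ∀ (u : ℝ → EuclideanSpace ℝ (Fin 3) → EuclideanSpace ℝ (Fin 3)) (U : EuclideanSpace ℝ (Fin 3) → EuclideanSpace ℝ (Fin 3)), (∀ c : ℝ, 0 < c → ∀ x : EuclideanSpace ℝ (Fin 3), U (c • x) = c⁻¹ • U x) → (∃ x : EuclideanSpace ℝ (Fin 3), U x ≠ 0) → (∀ y : EuclideanSpace ℝ (Fin 3), y ≠ 0 → Filter.Tendsto (fun t : ℝ => Real.sqrt (0 - t) • u t (Real.sqrt (0 - t) • y)) (nhdsWithin 0 (Set.Iio 0)) (nhds (U y))) → ∀ ρ : ℝ, 0 < ρ → ∀ M : ℝ, ∀ᶠ t in nhdsWithin (0 : ℝ) (Set.Iio 0), ∃ x ∈ Metric.ball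 (0 : EuclideanSpace ℝ (Fin 3)) (ρ * Real.sqrt (-t)), M < Real.sqrt (-t) * ‖u t x‖ := by
  intro u U hhom hne htail ρ hρ M
  obtain ⟨x₁, hx₁⟩ := hne
  -- (a) the profile vanishes at the origin, so its nonzero point is off the origin
  have hU0 : U 0 = 0 := by
    have h := hhom 2 two_pos 0
    rw [smul_zero] at h
    have h3 : ((1 : ℝ) - 2⁻¹) • U 0 = 0 := by
      rw [sub_smul, one_smul, sub_eq_zero]
      exact h
    rcases smul_eq_zero.1 h3 with h4 | h4
    · norm_num at h4
    · exact h4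
  have hx₁0 : x₁ ≠ 0 := by
    rintro rfl
    exact hx₁ hU0
  have hA : 0 < ‖U x₁‖ := norm_pos_iff.2 hx₁
  have hX : 0 < ‖x₁‖ := norm_pos_iff.2 hx₁0
  have hXne : ‖x₁‖ ≠ 0 := hX.ne'
  have hM1 : (0 : ℝ) < |M| + 1 := by positivity
  -- the small dilation factor along the ray of `x₁`
  obtain ⟨c, hc0, hcρ, hcM⟩ : ∃ c : ℝ, 0 < c ∧ c * ‖x₁‖ < ρ ∧ |M| < c⁻¹ * ‖U x₁‖ := by
    have h1 : 0 < ρ / (2 * ‖x₁‖) := div_pos hρ (mul_pos two_pos hX)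
    have h2 : 0 < ‖U x₁‖ / (|M| + 1) := div_pos hA hM1
    refine ⟨min (ρ / (2 * ‖x₁‖)) (‖U x₁‖ / (|M| + 1)), lt_min h1 h2, ?_, ?_⟩
    · calc min (ρ / (2 * ‖x₁‖)) (‖U x₁‖ / (|M| + 1)) * ‖x₁‖
          ≤ ρ / (2 * ‖x₁‖) * ‖x₁‖ := mul_le_mul_of_nonneg_right (min_le_left _ _) hX.le
        _ = ρ / 2 := by field_simp
        _ < ρ := by linarith
    · rw [lt_inv_mul_iff₀ (lt_min h1 h2)]
      calc min (ρ / (2 * ‖x₁‖)) (‖U x₁‖ / (|M| + 1)) * |M|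
          ≤ ‖U x₁‖ / (|M| + 1) * |M| :=
            mul_le_mul_of_nonneg_right (min_le_right _ _) (abs_nonneg M)
        _ < ‖U x₁‖ / (|M| + 1) * (|M| + 1) := mul_lt_mul_of_pos_left (lt_add_one _) h2
        _ = ‖U x₁‖ := by field_simp
  -- the point `y₀ := c • x₁` of the unit picture: nonzero, inside `B(0, ρ)`, with `‖U y₀‖ > |M|`
  set y₀ : EuclideanSpace ℝ (Fin 3) := c • x₁ with hy₀def
  have hy₀ : y₀ ≠ 0 := smul_ne_zero hc0.ne' hx₁0
  have hy₀norm : ‖y₀‖ < ρ := by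
    rw [hy₀def, norm_smul, Real.norm_eq_abs, abs_of_pos hc0]
    exact hcρ
  have hUy₀ : |M| < ‖U y₀‖ := by
    rw [hy₀def, hhom c hc0 x₁, norm_smul, Real.norm_eq_abs, abs_of_pos (inv_pos.2 hc0)]
    exact hcM
  -- (b) the tail at `y₀`, through the norm
  have hev := (htail y₀ hy₀).norm.eventually_const_lt hUy₀
  -- (c) read off the core point `x := √(−t) • y₀`
  filter_upwards [hev, self_mem_nhdsWithin] with t ht htneg
  rw [Set.mem_Iio] at htneg
  have hst : 0 < Real.sqrt (-t) := Real.sqrt_pos.2 (neg_pos.2 htneg)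
  rw [zero_sub, norm_smul, Real.norm_eq_abs, abs_of_pos hst] at ht
  refine ⟨Real.sqrt (-t) • y₀, ?_, (le_abs_self M).trans_lt ht⟩
  rw [Metric.mem_ball, dist_zero_right, norm_smul, Real.norm_eq_abs, abs_of_pos hst, mul_comm ρ]
  exact mul_lt_mul_of_pos_left hy₀norm hst

end Summit.NavierStokesRegularity.NavierStokesRegularity.Theorems
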